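import Mathlib
import Summits.ValiantsHypothesis.ValiantsHypothesis.Theorems.KPlusLogSqLawLiftingFiniteBasePatchwork

/-!
# Patchworking at FINITE base, part 3: the EXCESS LAW — a near-tropical pencil exceeds its tropical count by an even number,
at most twice the hidden slopes, window by window

HONEST FRAMING.  Helper file toward the lifting crux `WeakLifting` (stmt-ValiantsHypothesis-19561; aside `Lifting`
stmt-ValiantsHypothesis-19772, registered stub `stub_liftThin`) of route `KPlusLogSqLaw` (cell `pub-symmetroid`, seat
val-sym-lift-p1 g9, 2026-08-27).  DESIGN-LEVEL corollaries of the local Descartes rule for the patchworked pencil of ONE tropical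
design at finite base (parts 1–2: `…LiftingFiniteBaseDominance`, `…LiftingFiniteBasePatchwork`).  Nothing here asserts
`WeakLifting`, `TropicalB`, Conjecture B, `MatrixDescartes` (stmt-ValiantsHypothesis-18050) or anything about VP ≠ VNP; nothing is
claimed about general (far-from-tropical) pencils, whose windows merge.

SETTING as in parts 1–2: design `(d, v, ε)`, base `b > 1`, `f_b = det Σ_l X^{d_l} · patchMatrix b v ε l` with merged coefficients
`c_s(b)`, `N = m!·K^m` Leibniz terms, `N ≤ b^M`, terms dominant with margin `M` at integer slopes.

RESULTS.
* `signVar_cons_append_single_le` — PARITY BOOKKEEPING for `Var`: a real sequence with non-zero ends `x, y` and `L` non-zero interior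
  entries has `Var ≤ [xy < 0] + 2⌊(L + 1 − [xy < 0])/2⌋`, i.e. `Var − [xy < 0]` is even and at most `2⌈L/2⌉` — the sign changes beyond the
  end-to-end alternation come in PAIRS.
* `card_roots_window_le_alt_add_of_margin` — WINDOW EXCESS LAW: if `p₁` is margin-`M` dominant at `θ₁` and `p₂` at `θ₂ > θ₁`, then
  `#{zeros of f_b in (b^{θ₁}, b^{θ₂})} ≤ [termSign p₁ · termSign p₂ < 0] + 2·⌈H/2⌉`, `H` the number of HIDDEN slopes of the window
  (present slopes strictly between `D(p₁)` and `D(p₂)`); `H = 0` is the exact window of part 2, and in general the real excess of a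
  window over its tropical count `[alternation]` is at most twice its hidden slopes, rounded up to an even number — GAP-LIFT §4
  (S-near) of val-sym-lift-p4 («ζ₊(F) ≤ alt(D(F)) + 2·#{windows with a competing interior slope}» for `H ≤ 2` per window) as a
  theorem.
* `card_posRoots_le_card_alternating_add_of_margin` — CHAIN EXCESS LAW: along a margin-`M` dominant chain `θ_0 < ⋯ < θ_r` whose slopes
  span the present slopes, `ζ₊(f_b) ≤ #{k : termSign P_k termSign P_{k+1} < 0} + Σ_k 2·⌈H_k/2⌉`.  HONEST READING: summed over a spanning
  chain the local `Var`s add up to Descartes' `Var` of the whole coefficient sequence (additivity at the non-zero chain coefficients), so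
  as a TOTAL bound this is Descartes' rule coarsened through the chain; the content of this file is PER WINDOW (where the zeros sit, and
  that a window's excess over its alternation is even and carried by hidden slopes) and in the sign identification `c_{D(P_k)} ~ termSign P_k`.
* `…_of_isDominant` — the same three laws in the currency of the tree's `IsDominant` chains (`TropRow` data): margin `1`, every base
  `b ≥ N = m!·K^m`; in particular PATCHWORKING IS EXACT AT BASE `N` for dominant chains without hidden slopes
  (`card_posRoots_eq_card_alternating_of_isDominant`; the tree's `le_card_posRoots_patch` at base `N + 1` is its lower half).
No `def`.  [folklore]
-/

set_option linter.dupNamespace false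
set_option autoImplicit false

namespace Summit.ValiantsHypothesis.ValiantsHypothesis.Theorems.KPlusLogSqLaw.LocalDescartes

open Polynomial Finset
open scoped BigOperators
open Literature.Algebra.Polynomial (signVar signVarAux)
open Literature.Computability.AlgebraicComplexity.BD17 (signVar_cons_cons_of_ne_zero)
open Summit.ValiantsHypothesis.ValiantsHypothesis.Theorems.MatrixDescartes.Negative
  (patchMatrix tropWeight termSign IsDominant)
open Summit.ValiantsHypothesis.ValiantsHypothesis.Theorems.KPlusLogSqLaw.ExactPatchwork
  (exists_present_of_mem_support)

variable {m K : ℕ}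

/-! ## Parity bookkeeping for `Var` -/

/-- sign transfer through a non-zero middle term: `xy < 0` iff exactly one of `xz < 0`, `zy < 0`. [folklore] -/
theorem mul_neg_iff_xor {x y z : ℝ} (hx : x ≠ 0) (hy : y ≠ 0) (hz : z ≠ 0) :
    x * y < 0 ↔ ((x * z < 0) ↔ ¬ (z * y < 0)) := by
  have hkey : (x * z) * (z * y) = z ^ 2 * (x * y) := by ring
  have hz2 : 0 < z ^ 2 := by positivity
  have hC : x * y ≠ 0 := mul_ne_zero hx hy
  constructor
  · intro h
    have hprod : (x * z) * (z * y) < 0 := by rw [hkey]; exact mul_neg_of_pos_of_neg hz2 h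
    rcases mul_neg_iff.mp hprod with ⟨h1, h2⟩ | ⟨h1, h2⟩
    · exact ⟨fun h3 => absurd h3 (not_lt.mpr h1.le), fun h3 => absurd h2 h3⟩
    · exact ⟨fun _ => not_lt.mpr h2.le, fun _ => h1⟩
  · intro h
    by_contra hcon
    have hxy : 0 < x * y := lt_of_le_of_ne (not_lt.mp hcon) hC.symm
    have hprod : 0 < (x * z) * (z * y) := by rw [hkey]; exact mul_pos hz2 hxy
    rcases mul_pos_iff.mp hprod with ⟨h1, h2⟩ | ⟨h1, h2⟩
    · exact absurd (h.mpr (not_lt.mpr h2.le)) (not_lt.mpr h1.le)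
    · exact (h.mp h1) h2

/-- **PARITY BOOKKEEPING.**  A real sequence `x, L…, y` with non-zero ends has
`Var ≤ [xy < 0] + 2⌊(L⁎ + 1 − [xy < 0])/2⌋`, `L⁎` the number of non-zero interior entries: the sign changes beyond the end-to-end
alternation come in pairs. [folklore] -/
theorem signVar_cons_append_single_le (y : ℝ) (hy : y ≠ 0) :
    ∀ (L : List ℝ) (x : ℝ), x ≠ 0 →
      signVar (x :: (L ++ [y])) ≤ (if x * y < 0 then 1 else 0)
        + 2 * (((L.filter (fun z => z ≠ 0)).length + 1 - (if x * y < 0 then 1 else 0)) / 2)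
  | [], x, hx => by
    rw [List.nil_append, signVar_cons_cons_of_ne_zero hx hy, signVar_single, add_zero]
    by_cases h : x * y < 0
    · rw [if_pos h]; simp
    · rw [if_neg h]; simp
  | z :: L, x, hx => by
    by_cases hz : z = 0
    · subst hz
      rw [List.cons_append, signVar_cons_zero_cons]
      have ih := signVar_cons_append_single_le y hy L x hx
      have hfilt : ((0 :: L).filter (fun z => z ≠ 0)).length = (L.filter (fun z => z ≠ 0)).length := by simp
      rw [hfilt]
      exact ih
    · rw [List.cons_append, signVar_cons_cons_of_ne_zero hx hz]
      have ih := signVar_cons_append_single_le y hy L z hz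
      have hfilt : ((z :: L).filter (fun w => w ≠ 0)).length = (L.filter (fun w => w ≠ 0)).length + 1 := by simp [hz]
      rw [hfilt]
      set n := (L.filter (fun w => w ≠ 0)).length with hn
      have hxor := mul_neg_iff_xor hx hy hz
      by_cases hxz : x * z < 0 <;> by_cases hzy : z * y < 0
      · have hxy : ¬ (x * y < 0) := fun h => (hxor.mp h).mp hxz hzy
        rw [if_pos hxz, if_neg hxy]; rw [if_pos hzy] at ih; omega
      · have hxy : x * y < 0 := hxor.mpr ⟨fun _ => hzy, fun _ => hxz⟩
        rw [if_pos hxz, if_pos hxy]; rw [if_neg hzy] at ih; omega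
      · have hxy : x * y < 0 := hxor.mpr ⟨fun h => absurd h hxz, fun h => absurd hzy h⟩
        rw [if_neg hxz, if_pos hxy]; rw [if_pos hzy] at ih; omega
      · have hxy : ¬ (x * y < 0) := fun h => hxz ((hxor.mp h).mpr hzy)
        rw [if_neg hxz, if_neg hxy]; rw [if_neg hzy] at ih; omega

/-- **`Var` of a coefficient window with non-zero ends**: `Var(c_u, …, c_w) ≤ [c_u c_w < 0] + 2⌈H/2⌉`, `H` the number of support
exponents strictly between `u` and `w`. [folklore] -/
theorem signVar_window_le_alt_add (f : ℝ[X]) {u w : ℕ} (huw : u ≤ w) (hcu : f.coeff u ≠ 0) (hcw : f.coeff w ≠ 0) :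
    signVar ((List.range (w + 1 - u)).map (fun k => f.coeff (u + k)))
      ≤ (if f.coeff u * f.coeff w < 0 then 1 else 0)
        + 2 * ((((Finset.Ioo u w).filter (fun s => f.coeff s ≠ 0)).card + 1) / 2) := by
  classical
  rcases Nat.eq_or_lt_of_le huw with rfl | hlt
  · have : u + 1 - u = 1 := by omega
    rw [this]
    simp only [List.range_one, List.map_cons, List.map_nil, add_zero, signVar_single]
    exact Nat.zero_le _
  rw [window_eq_cons_append f hlt]
  refine (signVar_cons_append_single_le (f.coeff w) hcw _ _ hcu).trans ?_
  set a : ℕ := if f.coeff u * f.coeff w < 0 then 1 else 0 with ha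
  have hH : (((List.range (w - u - 1)).map (fun k => f.coeff (u + 1 + k))).filter (fun z => z ≠ 0)).length
      ≤ ((Finset.Ioo u w).filter (fun s => f.coeff s ≠ 0)).card := by
    rw [length_filter_map_range_eq_card]
    refine Finset.card_le_card_of_injOn (fun k => u + 1 + k) (fun k hk => ?_) (fun k₁ _ k₂ _ h => by simpa using h)
    rw [Finset.mem_coe, Finset.mem_filter, Finset.mem_range] at hk
    rw [Finset.mem_coe, Finset.mem_filter, Finset.mem_Ioo]
    obtain ⟨hk1, hk2⟩ := hk
    refine ⟨⟨?_, ?_⟩, hk2⟩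
    · show u < u + 1 + k
      omega
    · show u + 1 + k < w
      omega
  have ha1 : a ≤ 1 := by rw [ha]; split_ifs <;> omega
  omega

/-! ## The window excess law -/

/-- **WINDOW EXCESS LAW AT FINITE BASE.**  If `p₁` is dominant with margin `M` at the integer slope `θ₁` and `p₂` at `θ₂ > θ₁`, and
`N ≤ b^M`, then the distinct zeros of `f_b` in `(b^{θ₁}, b^{θ₂})` number at most `[termSign p₁ · termSign p₂ < 0] + 2·⌈H/2⌉`, where
`H` is the number of HIDDEN slopes of the window (slopes of present terms strictly between `D(p₁)` and `D(p₂)`): the real excess of a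
near-tropical window over its tropical count is even-rounded and at most twice its hidden slopes (`H = 0`: the exact window
`card_roots_window_eq_of_noHidden`). [folklore] -/
theorem card_roots_window_le_alt_add_of_margin (b : ℝ) (hb : 1 < b) (d : Fin K → ℕ) (v ε : Fin m → Fin m → Fin K → ℤ)
    (hε : ∀ i j l, (ε i j l).natAbs ≤ 1) (M : ℕ)
    (hN : (Fintype.card (Equiv.Perm (Fin m) × (Fin m → Fin K)) : ℝ) ≤ b ^ M)
    {θ₁ θ₂ : ℤ} (hθ : θ₁ < θ₂) (p₁ p₂ : Equiv.Perm (Fin m) × (Fin m → Fin K))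
    (hp₁ : termSign ε p₁ ≠ 0) (hp₂ : termSign ε p₂ ≠ 0)
    (hmar₁ : ∀ q, q ≠ p₁ → termSign ε q ≠ 0 → tropWeight d v θ₁ q + M ≤ tropWeight d v θ₁ p₁)
    (hmar₂ : ∀ q, q ≠ p₂ → termSign ε q ≠ 0 → tropWeight d v θ₂ q + M ≤ tropWeight d v θ₂ p₂) :
    (((∑ l, (X : ℝ[X]) ^ d l • (patchMatrix b v ε l).map C).det).roots.toFinset.filter
        (fun x => b ^ θ₁ < x ∧ x < b ^ θ₂)).card
      ≤ (if termSign ε p₁ * termSign ε p₂ < 0 then 1 else 0)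
        + 2 * ((((Finset.Ioo (∑ i, d (p₁.2 i)) (∑ i, d (p₂.2 i))).filter
            (fun s => ∃ q : Equiv.Perm (Fin m) × (Fin m → Fin K), termSign ε q ≠ 0 ∧ (∑ i, d (q.2 i)) = s)).card + 1) / 2) := by
  classical
  have hb0 : 0 < b := lt_trans one_pos hb
  set f := ((∑ l, (X : ℝ[X]) ^ d l • (patchMatrix b v ε l).map C).det) with hf
  set D₁ := ∑ i, d (p₁.2 i) with hD₁
  set D₂ := ∑ i, d (p₂.2 i) with hD₂
  have hD : D₁ ≤ D₂ := slope_le_of_margin d v ε hθ M p₁ p₂ hp₁ hp₂ hmar₁ hmar₂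
  have hs₁ := termSign_mul_coeff_pos_of_margin b hb d v ε hε θ₁ M p₁ hp₁ hmar₁ hN
  have hs₂ := termSign_mul_coeff_pos_of_margin b hb d v ε hε θ₂ M p₂ hp₂ hmar₂ hN
  rw [← hf, ← hD₁] at hs₁
  rw [← hf, ← hD₂] at hs₂
  have hc₁ : f.coeff D₁ ≠ 0 := fun h => by rw [h, mul_zero] at hs₁; exact lt_irrefl _ hs₁
  have hc₂ : f.coeff D₂ ≠ 0 := fun h => by rw [h, mul_zero] at hs₂; exact lt_irrefl _ hs₂
  -- the coefficient signs are the term signs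
  have hiff : f.coeff D₁ * f.coeff D₂ < 0 ↔ termSign ε p₁ * termSign ε p₂ < 0 := by
    have key : 0 < ((termSign ε p₁ : ℝ) * (termSign ε p₂ : ℝ)) * (f.coeff D₁ * f.coeff D₂) := by
      have := mul_pos hs₁ hs₂; linarith [this]
    constructor
    · intro h
      have : (termSign ε p₁ : ℝ) * (termSign ε p₂ : ℝ) < 0 := by
        by_contra hge; push Not at hge
        linarith [mul_nonpos_of_nonneg_of_nonpos hge h.le]
      exact_mod_cast this
    · intro h
      have h' : (termSign ε p₁ : ℝ) * (termSign ε p₂ : ℝ) < 0 := by exact_mod_cast h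
      by_contra hge; push Not at hge
      linarith [mul_nonpos_of_nonpos_of_nonneg h'.le hge]
  have h := card_roots_window_le_signVar_of_margin b hb d v ε hε M hN hθ p₁ p₂ hp₁ hp₂ hmar₁ hmar₂
  rw [← hf, ← hD₁, ← hD₂] at h
  refine h.trans ((signVar_window_le_alt_add f hD hc₁ hc₂).trans ?_)
  have hH : ((Finset.Ioo D₁ D₂).filter (fun s => f.coeff s ≠ 0)).card
      ≤ ((Finset.Ioo D₁ D₂).filter
          (fun s => ∃ q : Equiv.Perm (Fin m) × (Fin m → Fin K), termSign ε q ≠ 0 ∧ (∑ i, d (q.2 i)) = s)).card := by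
    refine Finset.card_le_card fun s hs => ?_
    rw [Finset.mem_filter] at hs ⊢
    exact ⟨hs.1, exists_present_of_mem_support b hb0 d v ε (Polynomial.mem_support_iff.mpr hs.2)⟩
  by_cases halt : termSign ε p₁ * termSign ε p₂ < 0
  · rw [if_pos (hiff.mpr halt), if_pos halt]; omega
  · rw [if_neg (fun h' => halt (hiff.mp h')), if_neg halt]; omega

/-! ## The chain excess law -/

/-- **CHAIN EXCESS LAW AT FINITE BASE.**  Along a chain `θ_0 < ⋯ < θ_r` of integer slopes at which the terms `P_0, …, P_r` are dominant
with margin `M` (`N ≤ b^M`) and whose slopes span the present slopes, the number of distinct positive zeros of `f_b` is at most the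
alternation count `#{k : termSign P_k · termSign P_{k+1} < 0}` plus `Σ_k 2·⌈H_k/2⌉`, `H_k` the hidden slopes of the `k`-th window: a
near-tropical pencil exceeds its tropical count by at most twice its hidden slopes, window by window. [folklore] -/
theorem card_posRoots_le_card_alternating_add_of_margin (b : ℝ) (hb : 1 < b) (d : Fin K → ℕ)
    (v ε : Fin m → Fin m → Fin K → ℤ) (hε : ∀ i j l, (ε i j l).natAbs ≤ 1) (M : ℕ)
    (hN : (Fintype.card (Equiv.Perm (Fin m) × (Fin m → Fin K)) : ℝ) ≤ b ^ M)
    (r : ℕ) (θ : Fin (r + 1) → ℤ) (hθ : StrictMono θ) (P : Fin (r + 1) → Equiv.Perm (Fin m) × (Fin m → Fin K))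
    (hP : ∀ k, termSign ε (P k) ≠ 0)
    (hmar : ∀ k q, q ≠ P k → termSign ε q ≠ 0 → tropWeight d v (θ k) q + M ≤ tropWeight d v (θ k) (P k))
    (hrange : ∀ q : Equiv.Perm (Fin m) × (Fin m → Fin K), termSign ε q ≠ 0 →
      (∑ i, d ((P 0).2 i)) ≤ (∑ i, d (q.2 i)) ∧ (∑ i, d (q.2 i)) ≤ ∑ i, d ((P (Fin.last r)).2 i)) :
    (((∑ l, (X : ℝ[X]) ^ d l • (patchMatrix b v ε l).map C).det).roots.toFinset.filter (fun t => 0 < t)).card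
      ≤ (Finset.univ.filter (fun k : Fin r => termSign ε (P k.castSucc) * termSign ε (P k.succ) < 0)).card
        + ∑ k : Fin r, 2 * ((((Finset.Ioo (∑ i, d ((P k.castSucc).2 i)) (∑ i, d ((P k.succ).2 i))).filter
            (fun s => ∃ q : Equiv.Perm (Fin m) × (Fin m → Fin K), termSign ε q ≠ 0 ∧ (∑ i, d (q.2 i)) = s)).card + 1) / 2) := by
  classical
  have hb0 : 0 < b := lt_trans one_pos hb
  set f := ((∑ l, (X : ℝ[X]) ^ d l • (patchMatrix b v ε l).map C).det) with hf
  have hsign : ∀ k, 0 < (termSign ε (P k) : ℝ) * f.coeff (∑ i, d ((P k).2 i)) :=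
    fun k => termSign_mul_coeff_pos_of_margin b hb d v ε hε (θ k) M (P k) (hP k) (hmar k) hN
  have hcu : ∀ k, f.coeff (∑ i, d ((P k).2 i)) ≠ 0 :=
    fun k h => by have := hsign k; rw [h, mul_zero] at this; exact lt_irrefl _ this
  have hf0 : f ≠ 0 := fun h => hcu 0 (by rw [h, Polynomial.coeff_zero])
  -- windows: localise each positive zero (distribution law of part 2)
  have hsum := card_posRoots_le_sum_signVar_of_margin b hb d v ε hε M hN r θ hθ P hP hmar
  rw [← hf] at hsum
  -- low part vanishes: no coefficient below `D(P 0)`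
  have hlow : signVar ((List.range ((∑ i, d ((P 0).2 i)) + 1)).map f.coeff) = 0 := by
    rw [List.range_succ, List.map_append, List.map_singleton]
    rw [signVar_append_of_forall_eq_zero _ _ fun x hx => ?_]
    · exact signVar_single _
    · rw [List.mem_map] at hx
      obtain ⟨k, hk, rfl⟩ := hx
      rw [List.mem_range] at hk
      by_contra hne
      obtain ⟨q, hq, hqs⟩ := exists_present_of_mem_support b hb0 d v ε (Polynomial.mem_support_iff.mpr hne)
      have := (hrange q hq).1
      rw [hqs] at this
      exact absurd this (not_le.mpr hk)
  -- high part vanishes: the degree is `D(P r)`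
  have hdeg : f.natDegree = ∑ i, d ((P (Fin.last r)).2 i) := by
    refine le_antisymm ?_ (Polynomial.le_natDegree_of_ne_zero (hcu _))
    obtain ⟨q, hq, hqs⟩ := exists_present_of_mem_support b hb0 d v ε (Polynomial.natDegree_mem_support_of_nonzero hf0)
    rw [← hqs]; exact (hrange q hq).2
  have hhigh : signVar ((List.range (f.natDegree + 1 - ∑ i, d ((P (Fin.last r)).2 i))).map
      (fun j => f.coeff ((∑ i, d ((P (Fin.last r)).2 i)) + j))) = 0 := by
    rw [hdeg, Nat.add_sub_cancel_left]
    simp only [List.range_one, List.map_cons, List.map_nil, add_zero, signVar_single]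
  rw [hlow, hhigh, zero_add, add_zero] at hsum
  refine hsum.trans ?_
  rw [Finset.card_filter, ← Finset.sum_add_distrib]
  refine Finset.sum_le_sum fun k _ => ?_
  -- one window
  have hlt : θ k.castSucc < θ k.succ := hθ Fin.castSucc_lt_succ
  have hD : (∑ i, d ((P k.castSucc).2 i)) ≤ ∑ i, d ((P k.succ).2 i) :=
    slope_le_of_margin d v ε hlt M _ _ (hP _) (hP _) (hmar _) (hmar _)
  refine (signVar_window_le_alt_add f hD (hcu _) (hcu _)).trans ?_
  have hiff : f.coeff (∑ i, d ((P k.castSucc).2 i)) * f.coeff (∑ i, d ((P k.succ).2 i)) < 0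
      ↔ termSign ε (P k.castSucc) * termSign ε (P k.succ) < 0 := by
    have key : 0 < ((termSign ε (P k.castSucc) : ℝ) * (termSign ε (P k.succ) : ℝ))
        * (f.coeff (∑ i, d ((P k.castSucc).2 i)) * f.coeff (∑ i, d ((P k.succ).2 i))) := by
      have := mul_pos (hsign k.castSucc) (hsign k.succ); linarith [this]
    constructor
    · intro h
      have : (termSign ε (P k.castSucc) : ℝ) * (termSign ε (P k.succ) : ℝ) < 0 := by
        by_contra hge; push Not at hge
        linarith [mul_nonpos_of_nonneg_of_nonpos hge h.le]
      exact_mod_cast this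
    · intro h
      have h' : (termSign ε (P k.castSucc) : ℝ) * (termSign ε (P k.succ) : ℝ) < 0 := by exact_mod_cast h
      by_contra hge; push Not at hge
      linarith [mul_nonpos_of_nonpos_of_nonneg h'.le hge]
  have hH : ((Finset.Ioo (∑ i, d ((P k.castSucc).2 i)) (∑ i, d ((P k.succ).2 i))).filter (fun s => f.coeff s ≠ 0)).card
      ≤ ((Finset.Ioo (∑ i, d ((P k.castSucc).2 i)) (∑ i, d ((P k.succ).2 i))).filter
          (fun s => ∃ q : Equiv.Perm (Fin m) × (Fin m → Fin K), termSign ε q ≠ 0 ∧ (∑ i, d (q.2 i)) = s)).card := by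
    refine Finset.card_le_card fun s hs => ?_
    rw [Finset.mem_filter] at hs ⊢
    exact ⟨hs.1, exists_present_of_mem_support b hb0 d v ε (Polynomial.mem_support_iff.mpr hs.2)⟩
  by_cases halt : termSign ε (P k.castSucc) * termSign ε (P k.succ) < 0
  · rw [if_pos (hiff.mpr halt), if_pos halt]; omega
  · rw [if_neg (fun h' => halt (hiff.mp h')), if_neg halt]; omega

/-! ## In the tree's `IsDominant` currency (margin `1`, base `b ≥ N`) -/

/-- **WINDOW LAW FOR THE TREE'S DOMINANT CHAINS** (margin `1`, base `b ≥ N = m!·K^m`): if `p₁` is `IsDominant` at `θ₁` and `p₂` at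
`θ₂ > θ₁`, the distinct zeros of `f_b` in `(b^{θ₁}, b^{θ₂})` number at most `[termSign p₁ · termSign p₂ < 0] + 2·⌈H/2⌉`, `H` the hidden
slopes of the window — the currency of `TropRow` / `TropRootLawAt` chains. [folklore] -/
theorem card_roots_window_le_alt_add_of_isDominant (b : ℝ) (d : Fin K → ℕ) (v ε : Fin m → Fin m → Fin K → ℤ)
    (hε : ∀ i j l, (ε i j l).natAbs ≤ 1)
    (hN : (Fintype.card (Equiv.Perm (Fin m) × (Fin m → Fin K)) : ℝ) ≤ b) (hb : 1 < b)
    {θ₁ θ₂ : ℤ} (hθ : θ₁ < θ₂) (p₁ p₂ : Equiv.Perm (Fin m) × (Fin m → Fin K))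
    (hp₁ : IsDominant d v ε θ₁ p₁) (hp₂ : IsDominant d v ε θ₂ p₂) :
    (((∑ l, (X : ℝ[X]) ^ d l • (patchMatrix b v ε l).map C).det).roots.toFinset.filter
        (fun x => b ^ θ₁ < x ∧ x < b ^ θ₂)).card
      ≤ (if termSign ε p₁ * termSign ε p₂ < 0 then 1 else 0)
        + 2 * ((((Finset.Ioo (∑ i, d (p₁.2 i)) (∑ i, d (p₂.2 i))).filter
            (fun s => ∃ q : Equiv.Perm (Fin m) × (Fin m → Fin K), termSign ε q ≠ 0 ∧ (∑ i, d (q.2 i)) = s)).card + 1) / 2) :=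
  card_roots_window_le_alt_add_of_margin b hb d v ε hε 1 (by rw [pow_one]; exact hN) hθ p₁ p₂ hp₁.1 hp₂.1
    (margin_one_of_isDominant d v ε θ₁ p₁ hp₁).2 (margin_one_of_isDominant d v ε θ₂ p₂ hp₂).2

/-- **PATCHWORKING IS EXACT AT BASE `b ≥ N` FOR THE TREE'S DOMINANT CHAINS WITHOUT HIDDEN SLOPES**: if `P_0, …, P_r` are
`IsDominant` at integer slopes `θ_0 < ⋯ < θ_r` (the data of a `TropRow` chain), every present slope lies in `[D(P_0), D(P_r)]` and none
strictly between consecutive `D(P_k)`, then for every base `b ≥ N = m!·K^m` (`b > 1`) the patchworked pencil has EXACTLY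
`#{k : termSign P_k · termSign P_{k+1} < 0}` distinct positive zeros of its determinant (the tree's `le_card_posRoots_patch`, base
`N + 1`, is the lower half). [folklore] -/
theorem card_posRoots_eq_card_alternating_of_isDominant (b : ℝ) (d : Fin K → ℕ) (v ε : Fin m → Fin m → Fin K → ℤ)
    (hε : ∀ i j l, (ε i j l).natAbs ≤ 1)
    (hN : (Fintype.card (Equiv.Perm (Fin m) × (Fin m → Fin K)) : ℝ) ≤ b) (hb : 1 < b)
    (r : ℕ) (θ : Fin (r + 1) → ℤ) (hθ : StrictMono θ) (P : Fin (r + 1) → Equiv.Perm (Fin m) × (Fin m → Fin K))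
    (hP : ∀ k, IsDominant d v ε (θ k) (P k))
    (hrange : ∀ q : Equiv.Perm (Fin m) × (Fin m → Fin K), termSign ε q ≠ 0 →
      (∑ i, d ((P 0).2 i)) ≤ (∑ i, d (q.2 i)) ∧ (∑ i, d (q.2 i)) ≤ ∑ i, d ((P (Fin.last r)).2 i))
    (hno : ∀ q : Equiv.Perm (Fin m) × (Fin m → Fin K), termSign ε q ≠ 0 → ∀ k : Fin r,
      ¬ ((∑ i, d ((P k.castSucc).2 i)) < (∑ i, d (q.2 i)) ∧ (∑ i, d (q.2 i)) < ∑ i, d ((P k.succ).2 i))) :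
    (((∑ l, (X : ℝ[X]) ^ d l • (patchMatrix b v ε l).map C).det).roots.toFinset.filter (fun t => 0 < t)).card
      = (Finset.univ.filter (fun k : Fin r => termSign ε (P k.castSucc) * termSign ε (P k.succ) < 0)).card :=
  card_posRoots_eq_card_alternating_of_margin b hb d v ε hε 1 (by rw [pow_one]; exact hN) r θ hθ P (fun k => (hP k).1)
    (fun k => (margin_one_of_isDominant d v ε (θ k) (P k) (hP k)).2) hrange hno

/-- **CHAIN EXCESS LAW FOR THE TREE'S DOMINANT CHAINS** (margin `1`, base `b ≥ N`): with the chain's slopes spanning the present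
slopes, `ζ₊(f_b) ≤ #{alternations} + Σ_k 2·⌈H_k/2⌉`. [folklore] -/
theorem card_posRoots_le_card_alternating_add_of_isDominant (b : ℝ) (d : Fin K → ℕ) (v ε : Fin m → Fin m → Fin K → ℤ)
    (hε : ∀ i j l, (ε i j l).natAbs ≤ 1)
    (hN : (Fintype.card (Equiv.Perm (Fin m) × (Fin m → Fin K)) : ℝ) ≤ b) (hb : 1 < b)
    (r : ℕ) (θ : Fin (r + 1) → ℤ) (hθ : StrictMono θ) (P : Fin (r + 1) → Equiv.Perm (Fin m) × (Fin m → Fin K))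
    (hP : ∀ k, IsDominant d v ε (θ k) (P k))
    (hrange : ∀ q : Equiv.Perm (Fin m) × (Fin m → Fin K), termSign ε q ≠ 0 →
      (∑ i, d ((P 0).2 i)) ≤ (∑ i, d (q.2 i)) ∧ (∑ i, d (q.2 i)) ≤ ∑ i, d ((P (Fin.last r)).2 i)) :
    (((∑ l, (X : ℝ[X]) ^ d l • (patchMatrix b v ε l).map C).det).roots.toFinset.filter (fun t => 0 < t)).card
      ≤ (Finset.univ.filter (fun k : Fin r => termSign ε (P k.castSucc) * termSign ε (P k.succ) < 0)).card
        + ∑ k : Fin r, 2 * ((((Finset.Ioo (∑ i, d ((P k.castSucc).2 i)) (∑ i, d ((P k.succ).2 i))).filter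
            (fun s => ∃ q : Equiv.Perm (Fin m) × (Fin m → Fin K), termSign ε q ≠ 0 ∧ (∑ i, d (q.2 i)) = s)).card + 1) / 2) :=
  card_posRoots_le_card_alternating_add_of_margin b hb d v ε hε 1 (by rw [pow_one]; exact hN) r θ hθ P (fun k => (hP k).1)
    (fun k => (margin_one_of_isDominant d v ε (θ k) (P k) (hP k)).2) hrange

end Summit.ValiantsHypothesis.ValiantsHypothesis.Theorems.KPlusLogSqLaw.LocalDescartes
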